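import Mathlib
import HarnessLib

/-!
# Route BalabanIR — crux 4 `BirGappedPhaseReduction` (item `stmt-HubbardSuperconductivity-2082`):
# TEMPORAL coercivity of a two-state transfer chain (zero spatial mode of the gapped BdG reference)

The reduction must land the fermion-induced pair-phase action INSIDE the coercive class of the
engine (hypothesis (C) of crux 2 `BirComplexStableXY`): `Re F ≥ c₀ Σ (1 - cos(φ_w - φ_{w'}))` over
ALL pairs of the space-time window, temporal pairs included. For SPATIAL misalignment the source is
crux 3 + trace Hölder (`…BirGappedPhaseReductionFermionWeight.lean`). For TEMPORAL misalignment the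
route records a worry (why-might-fail (iii) of this item: "temporal gradients have no coercivity
source in a compressible-phase action, only Gaussian/Berry control"). This file proves the temporal
counterpart in the simplest sector — slice-constant phases, the `k_s = 0` mode the canonical
projection integrates over — UNIFORMLY in the number of time slices.

Dictionary (informal; only the two-state algebra below is formalised). For slice-constant pair
phases `θ_τ`, gauge covariance `H_BdG(e^{iθ}Δ) = U(θ/2) H_BdG(Δ) U(θ/2)†` (tree:
`phaseGauge_exp_mul_bdgBondHamiltonian_mul_conjTranspose`) and cyclicity of the trace give
`Tr ∏_τ e^{-aH(θ_τ)} = Tr ∏_τ (e^{-aH} e^{-iδ_τ N/2})`, `δ_τ = θ_τ - θ_{τ+1}`, `Σ_τ δ_τ = 0`; the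
quasi-free trace factorises over momentum pairs `(k,-k)`, each contributing (twice, for the two
spin copies) the trace of a product of 2×2 TRANSFER STEPS `G_k · diag(1, e^{-iδ_τ})` on the
pair-number basis `{|0⟩, |k↑,-k↓⟩}`, `G_k = e^{-a h_k}`, `h_k = [[-ξ_k, Δ_k], [Δ̄_k, ξ_k]]`
(entries `cosh(aE_k) ± (ξ_k/E_k) sinh(aE_k)` on the diagonal and `(|Δ_k|/E_k) sinh(aE_k) > 0` off
it, after the diagonal gauge `diag(1, -e^{i arg Δ_k})`), plus a phase-blind singly-occupied sector
`2e^{-Maξ_k}`. So the temporal phase dependence of the fermionic weight is EXACTLY a product of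
two-state chains in which `δ_τ` multiplies the amplitude of "a Cooper pair occupies mode `k` at
slice `τ+1`": pair-number fluctuations between consecutive slices are the source of temporal phase
rigidity, present iff `Δ_k ≠ 0`.

Theorems (abstract: any entrywise nonnegative `G : Matrix (Fin 2) (Fin 2) ℝ`, any `0 ≤ κ` with
`κ (G_{b0}G_{0b'} + G_{b1}G_{1b'})² ≤ G_{b0}G_{0b'}·G_{b1}G_{1b'}` for the four `(b,b')`; phases as a list of
pairs `(e_σ, o_σ)` = a chain of even length `M = 2m`; `D_d = diag(1, e^{-id})`):
`twoState_norm_trace_prod_pairs_le` (`‖tr ∏_σ (G D_{e_σ} G D_{o_σ})‖ ≤ e^{-κ Σ_σ(1 - cos e_σ)} tr (G²)^m`),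
`…_pairs_le_snd` (the same with the `o_σ`, by the cyclic regrouping `trace_prod_pairs_regroup` /
`trace_prod_conj_regroup`), **`twoState_norm_trace_prod_le`**
(`‖tr ∏_τ (G D_{δ_τ})‖ ≤ e^{-(κ/2) Σ_τ (1 - cos δ_τ)} · tr G^M`: EVERY misalignment between consecutive
slices costs a factor, uniformly in `M`), `twoState_exists_conditionalVariance` (for entrywise positive
`G` such a `κ > 0` exists: `min_{b,b'} p_{bb'}(1 - p_{bb'})`, `p_{bb'}` the conditional probability, given
the states `b, b'` two steps apart, that the slice in between carries the pair — conditionally on the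
even slices the odd slices of a two-state Markov ring are independent, and
`|E e^{-iδn}| ≤ e^{-p(1-p)(1 - cos δ)}` for a Bernoulli(`p`) variable: a Dobrushin-type one-site bound,
here as entrywise domination `|(G D_d G)_{bb'}| ≤ e^{-κ(1 - cos d)} (G²)_{bb'}` propagated through the
product and the trace).
Reading (for the reduction and the pending joint restatement of cruxes 2/4): (i) no degradation as
`M → ∞` in this sector; (ii) per mode and slice `κ_k = p_k(1-p_k)`, `p_k ≍ (|Δ_k|/E_k)²·O(1)` at
`aE_k = O(1)` — extensive after the product over the `L²` modes (heuristically `≍ ρΔ·L²` per slice at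
`a = 1/Δ`, the order of the spatial factor `a·c₀` of crux 3), i.e. evidence for KEEPING temporal pairs in
(C) when the engine is restated, against caveat (iii); (iii) the only phase-blind part is the
singly-occupied sector, of relative weight `≤ 2e^{-MaE_k}`; (iv) `(C)` constrains `|w|` only, and no
linear (Berry) term appears at zero winding `Σ δ_τ = 0`.
Numerics (pure python, this session): for `G = e^{-ah}`, `(ξ,Δ,a) = (0,1,1)`, the minimum over
3000 random `δ ∈ [-π,π]^M` with `Σδ = 0` of `-log(|w|/w(0))/Σ_τ(1 - cos δ_τ)` is `0.18–0.34` for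
`M = 2…32`, against the proved `κ/2 = 0.116`; `0.049–0.052` at `(2,1,1)`; `0.0025` at `(3,0.3,1)`.

`Theses`-free, no definitions. References: P. G. de Gennes, *Superconductivity of Metals and Alloys*
(1966) Ch. 4 (pair-occupation representation of BCS states); R. L. Dobrushin, Theory Probab. Appl. 13
(1968) 197 (one-site conditional bounds); B. Simon, *Statistical Mechanics of Lattice Gases* I §II.5. [folklore]
-/

noncomputable section

namespace Summit.HubbardSuperconductivity.HubbardSuperconductivity.Theorems

open Matrix Complex

/-! ### Entrywise domination is stable under products and traces -/

section Domination

variable {n : Type*} [Fintype n] [DecidableEq n]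

omit [DecidableEq n] in
/-- If `‖A i j‖ ≤ A' i j` and `‖B i j‖ ≤ B' i j` entrywise, then `‖(A B) i j‖ ≤ (A' B') i j`. [folklore] -/
theorem norm_mul_apply_le_of_forall {A B : Matrix n n ℂ} {A' B' : Matrix n n ℝ}
    (hA : ∀ i j, ‖A i j‖ ≤ A' i j) (hB : ∀ i j, ‖B i j‖ ≤ B' i j) (i j : n) :
    ‖(A * B) i j‖ ≤ (A' * B') i j := by
  rw [Matrix.mul_apply, Matrix.mul_apply]
  refine (norm_sum_le _ _).trans (Finset.sum_le_sum fun k _ => ?_)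
  rw [norm_mul]
  exact mul_le_mul (hA i k) (hB k j) (norm_nonneg _) ((norm_nonneg _).trans (hA i k))

/-- Entrywise domination passes to products of lists: if every complex factor is dominated
entrywise in norm by the corresponding nonnegative real factor, so is the product. [folklore] -/
theorem norm_list_prod_apply_le_of_forall :
    ∀ (l : List (Matrix n n ℂ × Matrix n n ℝ)), (∀ q ∈ l, ∀ i j, ‖q.1 i j‖ ≤ q.2 i j) →
      ∀ i j, ‖(l.map Prod.fst).prod i j‖ ≤ (l.map Prod.snd).prod i j
  | [], _, i, j => by
      simp only [List.map_nil, List.prod_nil, Matrix.one_apply]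
      split_ifs <;> simp
  | q :: l, h, i, j => by
      simp only [List.map_cons, List.prod_cons]
      exact norm_mul_apply_le_of_forall (h q (by simp))
        (norm_list_prod_apply_le_of_forall l (fun q' hq' => h q' (by simp [hq']))) i j

omit [DecidableEq n] in
/-- `‖tr A‖ ≤ tr A'` when `‖A i j‖ ≤ A' i j` entrywise. [folklore] -/
theorem norm_trace_le_trace_of_forall {A : Matrix n n ℂ} {A' : Matrix n n ℝ}
    (h : ∀ i j, ‖A i j‖ ≤ A' i j) : ‖A.trace‖ ≤ A'.trace :=
  (norm_sum_le _ _).trans (Finset.sum_le_sum fun i _ => h i i)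

/-- The trace of a product of a list of square matrices is invariant under rotation of the list
(cyclicity of the trace). [folklore] -/
theorem trace_prod_rotate_one {R : Type*} [CommRing R] (l : List (Matrix n n R)) :
    (l.rotate 1).prod.trace = l.prod.trace := by
  cases l with
  | nil => simp
  | cons a t =>
      rw [List.rotate_cons_succ, List.rotate_zero, List.prod_append, List.prod_singleton,
        List.prod_cons, Matrix.trace_mul_comm]

/-- Products of pairs are products of the interleaved list. [folklore] -/
theorem prod_map_mul_eq_prod_flatMap {M : Type*} [Monoid M] :
    ∀ (l : List (M × M)), (l.map fun p => p.1 * p.2).prod = (l.flatMap fun p => [p.1, p.2]).prod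
  | [] => rfl
  | p :: t => by
      rw [List.map_cons, List.prod_cons, List.flatMap_cons, List.prod_append,
        prod_map_mul_eq_prod_flatMap t]
      simp [mul_assoc]

/-- The interleaved list of the re-paired sequence `(b₀,a₁), (b₁,a₂), …, (b_k, a_end)`.
[folklore] -/
theorem flatMap_zip_cons_append {M : Type*} (b : M) :
    ∀ (a : M) (t : List (M × M)),
      ((a :: t.map Prod.snd).zip (t.map Prod.fst ++ [b])).flatMap (fun p => [p.1, p.2]) =
        a :: (t.flatMap fun p => [p.1, p.2]) ++ [b]
  | a, [] => rfl
  | a, q :: t => by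
      simp only [List.map_cons, List.cons_append, List.zip_cons_cons, List.flatMap_cons]
      rw [flatMap_zip_cons_append b q.2 t]
      rfl

/-- **Regrouping a cyclic product of pairs.** For a nonempty list of pairs
`(a₀,b₀), …, (a_k,b_k)`, `tr ∏_σ (a_σ b_σ) = tr ∏_σ (b_σ a_{σ+1})` (indices mod `k+1`): the trace of
the interleaved product is invariant under rotation by one factor. [folklore] -/
theorem trace_prod_pairs_regroup {R : Type*} [CommRing R] (ps : List (Matrix n n R × Matrix n n R))
    (hps : ps ≠ []) :
    ((ps.map fun p : Matrix n n R × Matrix n n R => p.1 * p.2).prod).trace =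
      (((ps.map Prod.snd).zip ((ps.map Prod.fst).rotate 1)).map
        fun p : Matrix n n R × Matrix n n R => p.1 * p.2).prod.trace := by
  obtain ⟨p, t, rfl⟩ := List.exists_cons_of_ne_nil hps
  rw [prod_map_mul_eq_prod_flatMap, prod_map_mul_eq_prod_flatMap, List.map_cons, List.map_cons,
    List.rotate_cons_succ, List.rotate_zero, flatMap_zip_cons_append, List.flatMap_cons,
    ← trace_prod_rotate_one (([p.1, p.2] ++ List.flatMap (fun p => [p.1, p.2]) t))]
  congr 2

/-- **Cyclic gauge regrouping.** For any square matrix `X` and any nonempty list of pairs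
`(U_τ, V_τ)`: `tr ∏_τ (U_τ X V_τ) = tr ∏_τ (V_τ U_{τ+1} X)` (indices mod the length). With
`V_τ = U_τ⁻¹`, `U_τ = e^{iθ_τN/2}` and `X = e^{-aH}` this is the first line of the dictionary in the
module docstring: slice-wise gauge rotations of the reference weight become insertions of the
RELATIVE rotations `U_τ⁻¹U_{τ+1}` between consecutive slices. [folklore] -/
theorem trace_prod_conj_regroup {R : Type*} [CommRing R] (X : Matrix n n R)
    (us : List (Matrix n n R × Matrix n n R)) (hus : us ≠ []) :
    ((us.map fun p : Matrix n n R × Matrix n n R => p.1 * X * p.2).prod).trace =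
      (((us.map Prod.snd).zip ((us.map Prod.fst).rotate 1)).map
        fun p : Matrix n n R × Matrix n n R => p.1 * p.2 * X).prod.trace := by
  have h := trace_prod_pairs_regroup (us.map fun p => (p.1 * X, p.2)) (by simpa using hus)
  rw [List.map_map, List.map_map, List.map_map] at h
  have e1 : ((fun p : Matrix n n R × Matrix n n R => p.1 * p.2) ∘
      fun p : Matrix n n R × Matrix n n R => (p.1 * X, p.2)) =
      fun p : Matrix n n R × Matrix n n R => p.1 * X * p.2 := rfl
  have e2 : (Prod.snd ∘ fun p : Matrix n n R × Matrix n n R => (p.1 * X, p.2)) = Prod.snd := rfl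
  have e3 : (Prod.fst ∘ fun p : Matrix n n R × Matrix n n R => (p.1 * X, p.2)) =
      (fun U => U * X) ∘ Prod.fst := rfl
  rw [e1, e2, e3, ← List.map_map, ← List.map_rotate, ← List.map_id (us.map Prod.snd), List.zip_map]
    at h
  rw [h, List.map_map]
  congr 2
  refine List.map_congr_left fun p _ => ?_
  simp [mul_assoc]

end Domination

/-! ### The two-term phase sum -/

/-- For `α, β ≥ 0` and `0 ≤ κ` with `κ (α+β)² ≤ α β`:
`‖α + β e^{-id}‖ ≤ e^{-κ(1 - cos d)} (α + β)` — a convex combination of two unit phasors is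
strictly inside the unit disc, quantitatively in the misalignment `1 - cos d`. [folklore] -/
theorem norm_add_mul_cexp_le {α β κ : ℝ} (hα : 0 ≤ α) (hβ : 0 ≤ β) (hκ0 : 0 ≤ κ)
    (hκ : κ * (α + β) ^ 2 ≤ α * β) (d : ℝ) :
    ‖(α : ℂ) + β * cexp (-(I * d))‖ ≤ Real.exp (-(κ * (1 - Real.cos d))) * (α + β) := by
  have hsq : ‖(α : ℂ) + β * cexp (-(I * d))‖ ^ 2 = (α + β) ^ 2 - 2 * (α * β) * (1 - Real.cos d) := by
    have hre : ((α : ℂ) + β * cexp (-(I * d))).re = α + β * Real.cos d := by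
      have : -(I * (d : ℂ)) = ((-d : ℝ) : ℂ) * I := by push_cast; ring
      rw [this, Complex.add_re, Complex.ofReal_re, Complex.re_ofReal_mul, Complex.exp_ofReal_mul_I_re,
        Real.cos_neg]
    have him : ((α : ℂ) + β * cexp (-(I * d))).im = -(β * Real.sin d) := by
      have : -(I * (d : ℂ)) = ((-d : ℝ) : ℂ) * I := by push_cast; ring
      rw [this, Complex.add_im, Complex.ofReal_im, Complex.im_ofReal_mul,
        Complex.exp_ofReal_mul_I_im, Real.sin_neg, zero_add, mul_neg]
    rw [Complex.sq_norm, Complex.normSq_apply, hre, him]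
    linear_combination (β ^ 2) * Real.sin_sq_add_cos_sq d
  have hx : 0 ≤ κ * (1 - Real.cos d) := mul_nonneg hκ0 (sub_nonneg.2 (Real.cos_le_one d))
  have h1 : ‖(α : ℂ) + β * cexp (-(I * d))‖ ^ 2 ≤
      (Real.exp (-(κ * (1 - Real.cos d))) * (α + β)) ^ 2 := by
    rw [hsq, mul_pow, ← Real.exp_nat_mul]
    have h2 : (α + β) ^ 2 - 2 * (α * β) * (1 - Real.cos d) ≤
        (1 - 2 * (κ * (1 - Real.cos d))) * (α + β) ^ 2 := by
      nlinarith [sub_nonneg.2 (Real.cos_le_one d), sq_nonneg (α + β)]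
    have h3 : 1 - 2 * (κ * (1 - Real.cos d)) ≤ Real.exp ((2 : ℕ) * -(κ * (1 - Real.cos d))) := by
      have e : ((2 : ℕ) : ℝ) * -(κ * (1 - Real.cos d)) = -(2 * (κ * (1 - Real.cos d))) := by
        push_cast; ring
      rw [e]
      have := Real.add_one_le_exp (-(2 * (κ * (1 - Real.cos d))))
      linarith
    exact h2.trans (mul_le_mul_of_nonneg_right h3 (sq_nonneg _))
  exact (pow_le_pow_iff_left₀ (norm_nonneg _) (by positivity) two_ne_zero).1 h1

/-! ### The two-state transfer step `G · diag(1, e^{-id})` and the pair bound -/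

section TwoState

variable (G : Matrix (Fin 2) (Fin 2) ℝ)

/-- Entries of a PAIR of transfer steps: the phase `d` of the first step is sandwiched between two
`G`'s, `(G D_d G D_{d'}) b b' = (G_{b0}G_{0b'} + G_{b1}G_{1b'} e^{-id}) · (D_{d'})_{b'}`. [folklore] -/
theorem twoState_pair_apply (d d' : ℝ) (b b' : Fin 2) :
    (G.map ((↑) : ℝ → ℂ) * diagonal ![(1 : ℂ), cexp (-(I * d))] *
        (G.map ((↑) : ℝ → ℂ) * diagonal ![(1 : ℂ), cexp (-(I * d'))])) b b' =
      ((G b 0 * G 0 b' : ℝ) + (G b 1 * G 1 b' : ℝ) * cexp (-(I * d))) *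
        ![(1 : ℂ), cexp (-(I * d'))] b' := by
  rw [Matrix.mul_apply, Fin.sum_univ_two]
  simp only [mul_diagonal, Matrix.map_apply, Matrix.cons_val_zero, Matrix.cons_val_one]
  push_cast
  ring

/-- The phase factors `(D_{d'})_{b'}` have modulus one. [folklore] -/
theorem norm_vecCons_one_cexp_apply (d' : ℝ) (b' : Fin 2) :
    ‖(![(1 : ℂ), cexp (-(I * d'))] : Fin 2 → ℂ) b'‖ = 1 := by
  fin_cases b' <;> simp [Complex.norm_exp]

/-- **Pair bound.** For an entrywise nonnegative `G` and `0 ≤ κ` below the four conditional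
variances, every entry of a pair of transfer steps is dominated by `e^{-κ(1 - cos d)} (G²)_{bb'}`,
`d` the sandwiched phase. [folklore] -/
theorem twoState_norm_pair_apply_le (hG : ∀ i j, 0 ≤ G i j) {κ : ℝ} (hκ0 : 0 ≤ κ)
    (hκ : ∀ b b' : Fin 2, κ * (G b 0 * G 0 b' + G b 1 * G 1 b') ^ 2 ≤ (G b 0 * G 0 b') * (G b 1 * G 1 b'))
    (d d' : ℝ) (b b' : Fin 2) :
    ‖(G.map ((↑) : ℝ → ℂ) * diagonal ![(1 : ℂ), cexp (-(I * d))] *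
        (G.map ((↑) : ℝ → ℂ) * diagonal ![(1 : ℂ), cexp (-(I * d'))])) b b'‖ ≤
      (Real.exp (-(κ * (1 - Real.cos d))) • (G * G)) b b' := by
  rw [twoState_pair_apply, norm_mul, norm_vecCons_one_cexp_apply, mul_one, Matrix.smul_apply,
    Matrix.mul_apply, Fin.sum_univ_two, smul_eq_mul]
  exact norm_add_mul_cexp_le (mul_nonneg (hG b 0) (hG 0 b')) (mul_nonneg (hG b 1) (hG 1 b')) hκ0
    (hκ b b') d

/-- **Temporal coercivity of a two-state chain, paired form.** For an entrywise nonnegative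
two-state transfer matrix `G`, `0 ≤ κ` below the four conditional variances, and any list of phase
PAIRS `(d_σ, d'_σ)`:
`‖tr ∏_σ (G D_{d_σ} G D_{d'_σ})‖ ≤ exp(-κ Σ_σ (1 - cos d_σ)) · tr (G²)^{#pairs}` — every SANDWICHED
phase costs a factor `e^{-κ(1 - cos d_σ)}`, uniformly in the length of the chain. [folklore] -/
theorem twoState_norm_trace_prod_pairs_le (hG : ∀ i j, 0 ≤ G i j) {κ : ℝ} (hκ0 : 0 ≤ κ)
    (hκ : ∀ b b' : Fin 2, κ * (G b 0 * G 0 b' + G b 1 * G 1 b') ^ 2 ≤ (G b 0 * G 0 b') * (G b 1 * G 1 b'))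
    (ps : List (ℝ × ℝ)) :
    ‖((ps.map fun p => G.map ((↑) : ℝ → ℂ) * diagonal ![(1 : ℂ), cexp (-(I * p.1))] *
        (G.map ((↑) : ℝ → ℂ) * diagonal ![(1 : ℂ), cexp (-(I * p.2))])).prod).trace‖ ≤
      Real.exp (-(κ * (ps.map fun p => 1 - Real.cos p.1).sum)) * ((G * G) ^ ps.length).trace := by
  -- entrywise domination of each pair by `e^{-κ(1-cos d)} • G²`, then of the product
  set l : List (Matrix (Fin 2) (Fin 2) ℂ × Matrix (Fin 2) (Fin 2) ℝ) :=
    ps.map fun p => (G.map ((↑) : ℝ → ℂ) * diagonal ![(1 : ℂ), cexp (-(I * p.1))] *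
        (G.map ((↑) : ℝ → ℂ) * diagonal ![(1 : ℂ), cexp (-(I * p.2))]),
      Real.exp (-(κ * (1 - Real.cos p.1))) • (G * G)) with hl
  have hdom : ∀ q ∈ l, ∀ i j, ‖q.1 i j‖ ≤ q.2 i j := by
    intro q hq i j
    obtain ⟨p, -, rfl⟩ := List.mem_map.1 hq
    exact twoState_norm_pair_apply_le G hG hκ0 hκ p.1 p.2 i j
  have h1 := norm_trace_le_trace_of_forall (norm_list_prod_apply_le_of_forall l hdom)
  have hfst : l.map Prod.fst = ps.map fun p =>
      G.map ((↑) : ℝ → ℂ) * diagonal ![(1 : ℂ), cexp (-(I * p.1))] *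
        (G.map ((↑) : ℝ → ℂ) * diagonal ![(1 : ℂ), cexp (-(I * p.2))]) := by
    rw [hl, List.map_map]; rfl
  have hsnd : (l.map Prod.snd).prod =
      Real.exp (-(κ * (ps.map fun p => 1 - Real.cos p.1).sum)) • (G * G) ^ ps.length := by
    rw [hl, List.map_map]
    clear hfst hdom h1 hl l
    induction ps with
    | nil => simp
    | cons p t ih =>
        simp only [List.map_cons, List.prod_cons, Function.comp_apply, List.sum_cons,
          List.length_cons] at ih ⊢
        rw [ih, smul_mul_smul_comm, ← Real.exp_add, pow_succ']
        congr 1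
        ring_nf
  rw [hfst, hsnd, Matrix.trace_smul, smul_eq_mul] at h1
  exact h1

/-- The same bound with the roles of the two phases in each pair exchanged after REGROUPING:
for a nonempty list of phase pairs `(e_σ, o_σ)`, `‖tr ∏_σ (G D_{e_σ} G D_{o_σ})‖` is also bounded by
`exp(-κ Σ_σ (1 - cos o_σ)) · tr (G²)^{#pairs}` (the `o`-phases are sandwiched in the rotated
grouping `∏_σ (G D_{o_σ} G D_{e_{σ+1}})`, `trace_prod_pairs_regroup`). [folklore] -/
theorem twoState_norm_trace_prod_pairs_le_snd (hG : ∀ i j, 0 ≤ G i j) {κ : ℝ} (hκ0 : 0 ≤ κ)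
    (hκ : ∀ b b' : Fin 2, κ * (G b 0 * G 0 b' + G b 1 * G 1 b') ^ 2 ≤ (G b 0 * G 0 b') * (G b 1 * G 1 b'))
    (ps : List (ℝ × ℝ)) :
    ‖((ps.map fun p => G.map ((↑) : ℝ → ℂ) * diagonal ![(1 : ℂ), cexp (-(I * p.1))] *
        (G.map ((↑) : ℝ → ℂ) * diagonal ![(1 : ℂ), cexp (-(I * p.2))])).prod).trace‖ ≤
      Real.exp (-(κ * (ps.map fun p => 1 - Real.cos p.2).sum)) * ((G * G) ^ ps.length).trace := by
  rcases eq_or_ne ps [] with rfl | hps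
  · simp
  -- the matrix pairs and their regrouping
  set F : ℝ → Matrix (Fin 2) (Fin 2) ℂ := fun d =>
    G.map ((↑) : ℝ → ℂ) * diagonal ![(1 : ℂ), cexp (-(I * d))] with hF
  set qs : List (Matrix (Fin 2) (Fin 2) ℂ × Matrix (Fin 2) (Fin 2) ℂ) :=
    ps.map fun p => (F p.1, F p.2) with hqs
  have hqs_ne : qs ≠ [] := by simpa [hqs] using hps
  have h1 : (ps.map fun p => F p.1 * F p.2) = qs.map fun q => q.1 * q.2 := by
    rw [hqs, List.map_map]; rfl
  -- the regrouped list is the image of the regrouped PHASE list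
  set ps' : List (ℝ × ℝ) := (ps.map Prod.snd).zip ((ps.map Prod.fst).rotate 1) with hps'
  have h2 : (qs.map Prod.snd).zip ((qs.map Prod.fst).rotate 1) = ps'.map fun p => (F p.1, F p.2) := by
    have e1 : qs.map Prod.snd = (ps.map Prod.snd).map F := by
      rw [hqs, List.map_map, List.map_map]; rfl
    have e2 : qs.map Prod.fst = (ps.map Prod.fst).map F := by
      rw [hqs, List.map_map, List.map_map]; rfl
    rw [e1, e2, ← List.map_rotate, List.zip_map, hps']
    rfl
  have h3 : ((ps.map fun p => F p.1 * F p.2).prod).trace =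
      ((ps'.map fun p => F p.1 * F p.2).prod).trace := by
    rw [h1, trace_prod_pairs_regroup qs hqs_ne, h2, List.map_map]
    rfl
  have hlen : ps'.length = ps.length := by
    rw [hps', List.length_zip, List.length_rotate, List.length_map, List.length_map, min_self]
  have hfst : ps'.map Prod.fst = ps.map Prod.snd := by
    rw [hps', List.map_fst_zip]
    rw [List.length_rotate, List.length_map, List.length_map]
  have h4 := twoState_norm_trace_prod_pairs_le G hG hκ0 hκ ps'
  rw [← h3, hlen] at h4
  have hsum : (ps'.map fun p => 1 - Real.cos p.1) = ps.map fun p => 1 - Real.cos p.2 := by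
    rw [show (ps'.map fun p => 1 - Real.cos p.1) = (ps'.map Prod.fst).map (fun x => 1 - Real.cos x) by
        rw [List.map_map]; rfl, hfst, List.map_map]
    rfl
  rw [hsum] at h4
  exact h4

/-- **Temporal coercivity of a two-state chain (even length, symmetric form).** For an entrywise
nonnegative two-state transfer matrix `G`, `0 ≤ κ` below the four conditional variances, and a
chain of even length written as phase pairs `(e_σ, o_σ)`:
`‖tr ∏_σ (G D_{e_σ} G D_{o_σ})‖ ≤ exp(-(κ/2) Σ_σ [(1 - cos e_σ) + (1 - cos o_σ)]) · tr (G²)^{#pairs}`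
— EVERY phase misalignment between consecutive slices costs a factor `e^{-(κ/2)(1 - cos δ)}`,
uniformly in the length of the chain (geometric mean of the two paired bounds). [folklore] -/
theorem twoState_norm_trace_prod_le (hG : ∀ i j, 0 ≤ G i j) {κ : ℝ} (hκ0 : 0 ≤ κ)
    (hκ : ∀ b b' : Fin 2, κ * (G b 0 * G 0 b' + G b 1 * G 1 b') ^ 2 ≤ (G b 0 * G 0 b') * (G b 1 * G 1 b'))
    (ps : List (ℝ × ℝ)) :
    ‖((ps.map fun p => G.map ((↑) : ℝ → ℂ) * diagonal ![(1 : ℂ), cexp (-(I * p.1))] *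
        (G.map ((↑) : ℝ → ℂ) * diagonal ![(1 : ℂ), cexp (-(I * p.2))])).prod).trace‖ ≤
      Real.exp (-(κ / 2 * (ps.map fun p => (1 - Real.cos p.1) + (1 - Real.cos p.2)).sum)) *
        ((G * G) ^ ps.length).trace := by
  have hA := twoState_norm_trace_prod_pairs_le G hG hκ0 hκ ps
  have hB := twoState_norm_trace_prod_pairs_le_snd G hG hκ0 hκ ps
  set w := ‖((ps.map fun p => G.map ((↑) : ℝ → ℂ) * diagonal ![(1 : ℂ), cexp (-(I * p.1))] *
        (G.map ((↑) : ℝ → ℂ) * diagonal ![(1 : ℂ), cexp (-(I * p.2))])).prod).trace‖ with hw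
  set T := ((G * G) ^ ps.length).trace
  set Se := (ps.map fun p => 1 - Real.cos p.1).sum with hSe
  set So := (ps.map fun p => 1 - Real.cos p.2).sum with hSo
  have hsum : (ps.map fun p => (1 - Real.cos p.1) + (1 - Real.cos p.2)).sum = Se + So := by
    rw [hSe, hSo, List.sum_map_add]
  rw [hsum]
  have hw0 : 0 ≤ w := norm_nonneg _
  have hT0 : 0 ≤ T := (mul_nonneg_iff_of_pos_left (Real.exp_pos _)).1 (hw0.trans hA)
  have hsq : w ^ 2 ≤ (Real.exp (-(κ / 2 * (Se + So))) * T) ^ 2 := by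
    calc w ^ 2 = w * w := sq w
      _ ≤ (Real.exp (-(κ * Se)) * T) * (Real.exp (-(κ * So)) * T) :=
          mul_le_mul hA hB hw0 (le_trans hw0 hA)
      _ = (Real.exp (-(κ / 2 * (Se + So))) * T) ^ 2 := by
          rw [mul_pow, ← Real.exp_nat_mul, mul_mul_mul_comm, ← Real.exp_add, ← sq]
          congr 2
          push_cast
          ring
  exact (pow_le_pow_iff_left₀ hw0 (by positivity) two_ne_zero).1 hsq

/-- A canonical admissible constant: for an entrywise POSITIVE `G` there is `κ > 0` below the four
conditional variances (the minimum over `b, b'` of `p(1-p)`, `p = G_{b1}G_{1b'}/(G_{b0}G_{0b'}+G_{b1}G_{1b'})`). [folklore] -/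
theorem twoState_exists_conditionalVariance (hG : ∀ i j, 0 < G i j) :
    ∃ κ : ℝ, 0 < κ ∧
      ∀ b b' : Fin 2, κ * (G b 0 * G 0 b' + G b 1 * G 1 b') ^ 2 ≤ (G b 0 * G 0 b') * (G b 1 * G 1 b') := by
  set r : Fin 2 → Fin 2 → ℝ := fun b b' =>
    (G b 0 * G 0 b') * (G b 1 * G 1 b') / (G b 0 * G 0 b' + G b 1 * G 1 b') ^ 2 with hr
  have hrpos : ∀ b b', 0 < r b b' := fun b b' => by
    simp only [hr]
    have h1 := hG b 0; have h2 := hG 0 b'; have h3 := hG b 1; have h4 := hG 1 b'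
    positivity
  refine ⟨min (min (r 0 0) (r 0 1)) (min (r 1 0) (r 1 1)), by
    simp only [lt_min_iff]; exact ⟨⟨hrpos 0 0, hrpos 0 1⟩, hrpos 1 0, hrpos 1 1⟩, ?_⟩
  intro b b'
  have hle : min (min (r 0 0) (r 0 1)) (min (r 1 0) (r 1 1)) ≤ r b b' := by
    fin_cases b <;> fin_cases b' <;> simp
  have hpos : 0 < (G b 0 * G 0 b' + G b 1 * G 1 b') ^ 2 := by
    have h1 := hG b 0; have h2 := hG 0 b'; have h3 := hG b 1; have h4 := hG 1 b'
    positivity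
  calc min (min (r 0 0) (r 0 1)) (min (r 1 0) (r 1 1)) * (G b 0 * G 0 b' + G b 1 * G 1 b') ^ 2
      ≤ r b b' * (G b 0 * G 0 b' + G b 1 * G 1 b') ^ 2 := mul_le_mul_of_nonneg_right hle hpos.le
    _ = (G b 0 * G 0 b') * (G b 1 * G 1 b') := by
        simp only [hr]
        exact div_mul_cancel₀ _ hpos.ne'

end TwoState

end Summit.HubbardSuperconductivity.HubbardSuperconductivity.Theorems
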